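import Summits.BirchSwinnertonDyer.Rank1Residual.Additive.SignedTwistPlusLocalDictionary
import Summits.BirchSwinnertonDyer.Rank1Residual.Additive.SignedTwistKummerDictionary
import HarnessLib

/-!
# The PLUS Kummer dictionary at `p` of the signed-`η` twist: `x ∈ Kummer_W(E⁺(ℚ_n·E))`
# `↔ Θ_n x ∈ Kummer_V(E⁺(K_{n,v}))` (cell `bsd-potss`, seat `bsd-potss-ctrl` g2; second brick of
# T-e2-R1⁺ = the plus twin of x1b's P5-3b `SignedTwistKummerDictionary` (D4c); TARGET.md v6 §0.12 (e))

HONEST FRAMING (cell `bsd-potss`, run/shared/lean/pub/bsd-potss/; FULL-BSD rank ≤ 1 programme,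
tranche 1b): TOOL THEOREMS ONLY — no definition, no named Literature fact, no Summits-side fact
`def … : Prop`, no `sorry`, axioms standard; generic binders (`hD`, `hκ₀`, `hcop`) exactly as x1b's
(D4c); nothing is booked; no label / mark / count moves; nothing about (C1_η) or `BSD(W, p)` is claimed.

## What (setting of x1b's P5 series: `Θ_n = h1TransportLayer`, `Ψ = localTransport`, `K₀ ∋ θ = √c`,
## `V = C • W^{(c)}`, `η`, `κ`; the plus side has NO `m = −1` clause, so `E^{+,str} = E⁺` and no
## zero-clause / invisibility step appears)

* `localPairTrace_localTransport_symm_mem_signed_one` — (D4b3⁺) the η-AVERAGE: for ANY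
  `S ∈ E⁺_V(K₀ℚ_n·E)` the `W`-side pair trace `Tr_{K₀ℚ_n·E/ℚ_n·E}(Ψ⁻¹S)` lies in `E⁺_W(n)`
  (`Ψ` of it is the `η`-average `∑ η(δ) δ̃•S`, an `η`-eigen element of `E⁺_V`; (D4b2⁺)).
* `h1TransportLayer_mem_localKummer_towerSigned_one` — (D4c⁺ →): witness `(Θ∘φ∘incl, ΨQ, k)` from a
  plus witness `(φ, Q, k)` ((D4b1⁺) + the local square), verbatim x1b's (D4c →) minus the zero clause.
* `mem_localKummer_signed_one_of_h1TransportLayer_mem` — (D4c⁺ ←): x1b's coboundary absorption +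
  cochain lemma (G1) + prime-to-`p` division, with (D4b3⁺) in place of (D4b3).
* `mem_localKummerOverOfEmb_signed_one_iff` — (D4c⁺).

References: [Kobayashi2003] S. Kobayashi, Invent. Math. 152 (2003), §2 p. 4, Def. 1.1 (p. 2),
§4 p. 8 (`ε_η`); [SerreGaloisCohomology1997] I.§2.4.
-/

noncomputable section

open scoped Classical

open WeierstrassCurve Field

namespace Summit.BirchSwinnertonDyer.Rank1Residual.Additive.SignedTwist

open Literature.NumberTheory.EllipticCurves Literature.NumberTheory.GaloisRepresentations
  Literature.NumberTheory.EllipticCurves.Kobayashi2003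
  Summit.BirchSwinnertonDyer.Rank1Residual.AdditivePotMult

/-! ## §1 (D4b3⁺) the η-average of a plus point -/

section Average

open ZpExtension

variable (W : WeierstrassCurve ℚ) (K₀ : Type) [Field K₀] [NumberField K₀] {θ : K₀} {c : ℚ}
  (hθ : θ ∉ Set.range (algebraMap ℚ K₀)) (hc : θ ^ 2 = algebraMap ℚ K₀ c)
  {p : ℕ} [Fact p.Prime] (κ : ZpExtension ℚ p)
  {V : WeierstrassCurve ℚ} {C : VariableChange ℚ} (hCV : C • W.quadraticTwist c = V)
  {E : Type} [Field E] [Algebra ℚ E] (ι : AlgebraicClosure ℚ →ₐ[ℚ] AlgebraicClosure E)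
  (η : absoluteGaloisGroup ℚ →* ℤˣ)
  (hη : ∀ σ : absoluteGaloisGroup ℚ, η σ = 1 ↔ σ • rootInClosure K₀ θ = rootInClosure K₀ θ)

include hθ hc hη in
/-- **(D4b3⁺) the η-AVERAGE, plus side**: for ANY `S ∈ E⁺_V(K₀ℚ_n·E)` the `W`-side pair trace
`P_η := Tr_{K₀ℚ_n·E / ℚ_n·E}(Ψ⁻¹ S)` lies in Kobayashi's Def. 1.1 PLUS group of `W`: `Ψ P_η = S_η :=
∑_δ η(δ) δ̃ • S` is an `η`-eigen element of `E⁺_V(K₀ℚ_n·E)` (Γ_E-stability of the tower plus group),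
and (D4b2⁺) applies. (No trace-zero clause: the plus side has none.)
[cite: Kobayashi2003, §2 p. 4, §4 p. 8 (ε_η = (1/♯Δ) ∑ η⁻¹(τ) τ)] -/
theorem localPairTrace_localTransport_symm_mem_signed_one
    (hD : ∀ g : absoluteGaloisGroup ℚ, ∃ τ : absoluteGaloisGroup E,
      (resGalOfEmb ι τ)⁻¹ * g ∈ towerTopSubgroup κ K₀)
    (hκ₀ : ∀ x, ∃ g ∈ galRange (K := ℚ) K₀, κ g = x) [(galRange (K := ℚ) K₀).Normal]
    {n : ℕ} {S : localPoints V E}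
    (hS : S ∈ towerSignedLocalPointsOfEmb (towerSubgroup κ K₀) ι V 1 n) :
    localPairTraceOfEmb ι W (κ.layerSubgroup n) (towerSubgroup κ K₀ n)
        ((localTransport W K₀ hθ hc hCV E ι).symm S) ∈ signedLocalPointsOfEmb κ ι W 1 n := by
  classical
  obtain ⟨hSn, -, -⟩ := (mem_towerSignedLocalPointsOfEmb_iff _ ι V 1 n S).mp hS
  set Ψ := localTransport W K₀ hθ hc hCV E ι with hΨ
  set Q := Ψ.symm S with hQdef
  -- the local Galois group `Gal(K₀ℚ_n·E / ℚ_n·E) = A ⧸ N` and the character `χ = η ∘ res` on it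
  set A := localLayerSubgroupOfEmb κ ι n with hA
  haveI hUn : (localSubgroupOfEmb (towerSubgroup κ K₀ n) ι).Normal := Subgroup.normal_comap _
  set N := (localSubgroupOfEmb (towerSubgroup κ K₀ n) ι).subgroupOf A with hN
  haveI : Fintype (A ⧸ N) := Fintype.ofFinite _
  let χA : A →* ℤˣ := (η.comp (resGalOfEmb ι).toMonoidHom).comp A.subtype
  have hχA : ∀ a : A, χA a = η (resGalOfEmb ι (a : absoluteGaloisGroup E)) := fun a ↦ rfl
  have hχN : N ≤ χA.ker := fun u hu ↦ by
    rw [MonoidHom.mem_ker, hχA]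
    exact (hη _).mpr (apply_rootInClosure_of_mem K₀ (towerSubgroup_le_galRange κ K₀ n
      ((mem_localSubgroupOfEmb_iff _ ι _).mp (Subgroup.mem_subgroupOf.mp hu))))
  let χ : A ⧸ N →* ℤˣ := QuotientGroup.lift N χA hχN
  have hχ : ∀ a : A, χ (QuotientGroup.mk a) = η (resGalOfEmb ι (a : absoluteGaloisGroup E)) :=
    fun a ↦ QuotientGroup.lift_mk' N hχN a
  have hχout : ∀ q : A ⧸ N, χ q = η (resGalOfEmb ι ((q.out : A) : absoluteGaloisGroup E)) := fun q ↦ by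
    conv_lhs => rw [← QuotientGroup.out_eq' q]
    exact hχ _
  -- the η-average `S_η`
  set Sη : localPoints V E :=
    ∑ q : A ⧸ N, ((χ q : ℤˣ) : ℤ) • (((q.out : A) : absoluteGaloisGroup E) • S) with hSη
  -- `Ψ P_η = S_η`
  have hΨP : Ψ (localPairTraceOfEmb ι W (κ.layerSubgroup n) (towerSubgroup κ K₀ n) Q) = Sη := by
    rw [localPairTraceOfEmb_apply, map_sum]
    refine Finset.sum_congr rfl fun q _ ↦ ?_
    rw [hΨ, localTransport_smul W K₀ hθ hc hCV E ι η hη, ← hΨ, hQdef, AddEquiv.apply_symm_apply,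
      hχout]
  -- (a) `S_η ∈ E⁺_V(K₀ℚ_n·E)`
  have hSη_mem : Sη ∈ towerSignedLocalPointsOfEmb (towerSubgroup κ K₀) ι V 1 n :=
    AddSubgroup.sum_mem _ fun q _ ↦ AddSubgroup.zsmul_mem _
      (smul_mem_towerSignedLocalPointsOfEmb ι V (towerSubgroup κ K₀) 1 n _ hS) _
  -- (b) `S_η` is `η`-eigen under `A = Gal(ℚ̄_E/ℚ_n·E)`
  have hSη_eigen : ∀ τ ∈ localLayerSubgroupOfEmb κ ι n,
      τ • Sη = ((η (resGalOfEmb ι τ) : ℤˣ) : ℤ) • Sη := by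
    intro τ hτ
    set g : A ⧸ N := QuotientGroup.mk ⟨τ, hτ⟩ with hg
    have hperm : ∀ q : A ⧸ N, g * q = QuotientGroup.mk (s := N) (⟨τ, hτ⟩ * q.out) := fun q ↦ by
      conv_lhs => rw [← QuotientGroup.out_eq' q]
      exact (QuotientGroup.mk_mul N _ _).symm
    have hterm : ∀ q : A ⧸ N,
        τ • (((χ q : ℤˣ) : ℤ) • (((q.out : A) : absoluteGaloisGroup E) • S)) =
          ((η (resGalOfEmb ι τ) : ℤˣ) : ℤ) •
            (((χ (g * q) : ℤˣ) : ℤ) • ((((g * q).out : A) : absoluteGaloisGroup E) • S)) := by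
      intro q
      rw [galSmul_zsmul, smul_smul, hperm, out_smul_eq_of_mem_localFixedPointsOfEmb ι V hSn,
        Subgroup.coe_mul, smul_smul (((η (resGalOfEmb ι τ) : ℤˣ) : ℤ)), ← Units.val_mul, hχ,
        Subgroup.coe_mul, map_mul, map_mul, ← mul_assoc, Int.units_mul_self, one_mul, hχout]
    rw [hSη, Finset.smul_sum, Finset.smul_sum]
    simp_rw [hterm]
    exact Fintype.sum_equiv (Equiv.mulLeft g) _ _ fun q ↦ rfl
  -- conclude by (D4b2⁺) applied to `S_η`, and `Ψ⁻¹ S_η = P_η`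
  have hPη : localPairTraceOfEmb ι W (κ.layerSubgroup n) (towerSubgroup κ K₀ n) Q = Ψ.symm Sη := by
    rw [AddEquiv.eq_symm_apply]; exact hΨP
  rw [hPη]
  exact localTransport_symm_mem_signed_one_of_eigen W K₀ hθ hc κ hCV ι η hη hD hκ₀ hSη_mem hSη_eigen

end Average

/-! ## §2 (D4c⁺) the plus Kummer dictionary -/

section KummerForward

open ZpExtension

variable (W : WeierstrassCurve ℚ) (K₀ : Type) [Field K₀] [NumberField K₀] {θ : K₀} {c : ℚ}
  (hθ : θ ∉ Set.range (algebraMap ℚ K₀)) (hc : θ ^ 2 = algebraMap ℚ K₀ c)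
  (p : ℕ) [Fact p.Prime] (κ : ZpExtension ℚ p)
  {V : WeierstrassCurve ℚ} {C : VariableChange ℚ} (hCV : C • W.quadraticTwist c = V)
  (E : Type) [Field E] [Algebra ℚ E]
  (η : absoluteGaloisGroup ℚ →* ℤˣ)
  (hη : ∀ σ : absoluteGaloisGroup ℚ, η σ = 1 ↔ σ • rootInClosure K₀ θ = rootInClosure K₀ θ)

/-- **(D4c⁺ →)**: a class of `H¹(ℚ_n·(−), W[p^∞])` over `Gal(ℚ̄/ℚ_n)` satisfying the PLUS Kummer
condition (`E⁺_W(n) = E^{+,str}_W(n)`, no clause) at the chosen embedding goes, under `Θ_n`, to a class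
satisfying cc-typer-6's verbatim PLUS Kummer condition `E⁺_V(K_{n,v})`: witness `(Θ ∘ φ ∘ incl, Ψ Q, k)`
from a plus witness `(φ, Q, k)` ((D4b1⁺) + the local square). [cite: Kobayashi2003, §2 p. 4, Def. 1.1] -/
theorem h1TransportLayer_mem_localKummer_towerSigned_one
    (hD : ∀ g : absoluteGaloisGroup ℚ, ∃ τ : absoluteGaloisGroup E,
      (resGalOfEmb (closureEmb (K := ℚ) E) τ)⁻¹ * g ∈ towerTopSubgroup κ K₀)
    (hκ₀ : ∀ x, ∃ g ∈ galRange (K := ℚ) K₀, κ g = x) (n : ℕ)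
    {x : W.subgroupH1 p (κ.layerSubgroup n)}
    (hx : x ∈ localKummerOverOfEmb W p (κ.layerSubgroup n) (closureEmb (K := ℚ) E)
      (signedLocalPointsOfEmb κ (closureEmb (K := ℚ) E) W 1 n)) :
    h1TransportLayer W K₀ hθ hc p κ hCV n x ∈
      localKummerOverOfEmb V p (towerSubgroup κ K₀ n) (closureEmb (K := ℚ) E)
        (towerSignedLocalPointsOfEmb (towerSubgroup κ K₀) (closureEmb (K := ℚ) E) V 1 n) := by
  obtain ⟨φ, Q, k, hxφ, hP, hφ⟩ := hx
  have h1 := towerSubgroup_le_layerSubgroup K₀ p κ n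
  -- the transported cocycle `Θ ∘ φ ∘ incl` on `Gal(ℚ̄/K₀ℚ_n)`
  let φU := contOneCocycles.pullback (subgroupInclusion h1)
    (resHomOfEquivariant (subgroupInclusion h1) (AddMonoidHom.id (W.geomPrimaryTorsion p))
      fun _ _ ↦ rfl) φ
  refine ⟨contOneCocycles.push
      (geomTransport W K₀ hθ hc p hCV : W.geomPrimaryTorsion p →+ V.geomPrimaryTorsion p)
      (geomTransport_smul_of_le W K₀ hθ hc p hCV (towerSubgroup_le_galRange κ K₀ n)) φU,
    localTransport W K₀ hθ hc hCV E (closureEmb (K := ℚ) E) Q, k, ?_, ?_, fun τ ↦ ?_⟩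
  · -- the class: `Θ_n [φ] = [Θ ∘ φ ∘ incl]`
    rw [← hxφ, AddMonoidHom.comp_apply, resOfLe_oneCocycleClass, AddMonoidHom.coe_coe, h1Equiv_apply,
      Literature.NumberTheory.EllipticCurves.resH1Hom_id_oneCocycleClass]
  · -- `p^k • Ψ Q = Ψ (p^k • Q) ∈ E⁺_V(K_n)` by (D4b1⁺)
    rw [← map_nsmul]
    exact localTransport_mem_towerSigned_one W K₀ hθ hc κ hCV (closureEmb (K := ℚ) E) hD hκ₀ hP
  · -- the local shape, through the local square and the `Gal(ℚ̄/K₀)`-equivariance of `Ψ`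
    have hw := hφ (Subgroup.inclusion (localSubgroupOfEmb_tower_le_layer K₀ κ (closureEmb (K := ℚ) E) n) τ)
    rw [show resGalSubgroupOfEmb (κ.layerSubgroup n) (closureEmb (K := ℚ) E)
        (Subgroup.inclusion (localSubgroupOfEmb_tower_le_layer K₀ κ (closureEmb (K := ℚ) E) n) τ) =
        subgroupInclusion h1 (resGalSubgroupOfEmb (towerSubgroup κ K₀ n) (closureEmb (K := ℚ) E) τ)
        from Subtype.ext rfl, Subgroup.coe_inclusion] at hw
    rw [contOneCocycles.push_apply, contOneCocycles.pullback_apply]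
    change pointsMap V E ((geomTransport W K₀ hθ hc p hCV
      (φ.1 (subgroupInclusion h1 (resGalSubgroupOfEmb (towerSubgroup κ K₀ n) (closureEmb (K := ℚ) E) τ))) :
        V.geomPrimaryTorsion p) : V.geomPoints) = _
    rw [pointsMap_geomTransport]
    change localTransport W K₀ hθ hc hCV E (closureEmb (K := ℚ) E)
      (pointsMapOfEmb W (closureEmb (K := ℚ) E) _) = _
    rw [hw, map_sub, localTransport_smul_of_smul_root_eq W K₀ hθ hc hCV E (closureEmb (K := ℚ) E)
      (apply_rootInClosure_of_mem K₀ (towerSubgroup_le_galRange κ K₀ n τ.2))]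

end KummerForward

section KummerBackward

open ZpExtension

variable (W : WeierstrassCurve ℚ) (K₀ : Type) [Field K₀] [NumberField K₀] {θ : K₀} {c : ℚ}
  (hθ : θ ∉ Set.range (algebraMap ℚ K₀)) (hc : θ ^ 2 = algebraMap ℚ K₀ c)
  (p : ℕ) [Fact p.Prime] (κ : ZpExtension ℚ p)
  {V : WeierstrassCurve ℚ} {C : VariableChange ℚ} (hCV : C • W.quadraticTwist c = V)
  (E : Type) [Field E] [Algebra ℚ E]
  (η : absoluteGaloisGroup ℚ →* ℤˣ)
  (hη : ∀ σ : absoluteGaloisGroup ℚ, η σ = 1 ↔ σ • rootInClosure K₀ θ = rootInClosure K₀ θ)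

include hθ hη in
/-- **(D4c⁺ ←)**: conversely, if `Θ_n x` satisfies cc-typer-6's verbatim PLUS Kummer condition then
`x` satisfies the plus Kummer condition in `W`-coordinates. Word for word x1b's (D4c ←) (coboundary
absorption into the `V`-witness, `Q := Ψ⁻¹ R'`, the cochain lemma (G1) making `d • ψ` principal with
point `Q₂ = Tr(Q) − m₀` whose `p`-power multiple is the η-average trace, prime-to-`p` division
`d = [K_{n,v} : ℚ_{n,p}] ∣ [K₀ : ℚ]`), with (D4b3⁺) in place of (D4b3) and no zero clause.
[cite: Kobayashi2003, §2 p. 4, Def. 1.1] [cite: SerreGaloisCohomology1997, I.§2.4] -/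
theorem mem_localKummer_signed_one_of_h1TransportLayer_mem [(galRange (K := ℚ) K₀).Normal]
    (hD : ∀ g : absoluteGaloisGroup ℚ, ∃ τ : absoluteGaloisGroup E,
      (resGalOfEmb (closureEmb (K := ℚ) E) τ)⁻¹ * g ∈ towerTopSubgroup κ K₀)
    (hκ₀ : ∀ x, ∃ g ∈ galRange (K := ℚ) K₀, κ g = x)
    (hcop : (galRange (K := ℚ) K₀).index.Coprime p) (n : ℕ)
    {x : W.subgroupH1 p (κ.layerSubgroup n)}
    (hx : h1TransportLayer W K₀ hθ hc p κ hCV n x ∈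
      localKummerOverOfEmb V p (towerSubgroup κ K₀ n) (closureEmb (K := ℚ) E)
        (towerSignedLocalPointsOfEmb (towerSubgroup κ K₀) (closureEmb (K := ℚ) E) V 1 n)) :
    x ∈ localKummerOverOfEmb W p (κ.layerSubgroup n) (closureEmb (K := ℚ) E)
      (signedLocalPointsOfEmb κ (closureEmb (K := ℚ) E) W 1 n) := by
  classical
  have hp : p.Prime := Fact.out
  have h1 := towerSubgroup_le_layerSubgroup K₀ p κ n
  -- notation
  let ι : AlgebraicClosure ℚ →ₐ[ℚ] AlgebraicClosure E := closureEmb (K := ℚ) E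
  let Θ := geomTransport W K₀ hθ hc p hCV
  let Ψ := localTransport W K₀ hθ hc hCV E ι
  let B := localLayerSubgroupOfEmb κ ι n
  haveI hUnN : (localSubgroupOfEmb (towerSubgroup κ K₀ n) ι).Normal := Subgroup.normal_comap _
  let N : Subgroup B := (localSubgroupOfEmb (towerSubgroup κ K₀ n) ι).subgroupOf B
  haveI : N.Normal := inferInstance
  haveI : Fintype (B ⧸ N) := Fintype.ofFinite _
  -- a representative of `x` and the `V`-witness
  obtain ⟨φ, rfl⟩ := oneCocycleClass_surjective _ x
  obtain ⟨φV, R, k, hclass, hR, hφV⟩ := hx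
  -- `Θ ∘ φ ∘ incl` also represents `Θ_n x`
  let φU := contOneCocycles.pullback (subgroupInclusion h1)
    (resHomOfEquivariant (subgroupInclusion h1) (AddMonoidHom.id (W.geomPrimaryTorsion p))
      fun _ _ ↦ rfl) φ
  let φV' := contOneCocycles.push (Θ : W.geomPrimaryTorsion p →+ V.geomPrimaryTorsion p)
      (geomTransport_smul_of_le W K₀ hθ hc p hCV (towerSubgroup_le_galRange κ K₀ n)) φU
  have hclass' : oneCocycleClass _ φV' =
      h1TransportLayer W K₀ hθ hc p κ hCV n (oneCocycleClass _ φ) := by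
    rw [AddMonoidHom.comp_apply, resOfLe_oneCocycleClass, AddMonoidHom.coe_coe, h1Equiv_apply,
      Literature.NumberTheory.EllipticCurves.resH1Hom_id_oneCocycleClass]
  -- the coboundary `φV − φV' = ∂m`, `m ∈ V[p^∞]` of order `p^{k₁}`
  have hdiff : oneCocycleClass _ (φV - φV') = 0 := by
    rw [← oneCocycleClassₗ_apply, map_sub, oneCocycleClassₗ_apply, oneCocycleClassₗ_apply, hclass,
      hclass', sub_self]
  obtain ⟨m, hm⟩ := (oneCocycleClass_eq_zero_iff _ _).mp hdiff
  obtain ⟨k₁, hk₁⟩ := AddCommGroup.mem_primaryComponent.mp m.2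
  have hval : ∀ σ : towerSubgroup κ K₀ n,
      φV.1 σ = Θ (φ.1 (subgroupInclusion h1 σ)) + (σ • m - m) := by
    intro σ
    have h := hm σ
    rw [Submodule.coe_sub, ContinuousMap.sub_apply, sub_eq_iff_eq_add'] at h
    rw [h]
    rfl
  -- the corrected point `R' = R − ι_* m`
  let mE : localPoints V E := pointsMapOfEmb V ι ((m : V.geomPrimaryTorsion p) : V.geomPoints)
  let R' : localPoints V E := R - mE
  have hmE : p ^ k₁ • mE = 0 := by
    change p ^ k₁ • pointsMapOfEmb V ι _ = 0
    rw [← map_nsmul, hk₁, map_zero]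
  have hR' : p ^ (k + k₁) • R' =
      p ^ k₁ • (p ^ k • R) := by
    change p ^ (k + k₁) • (R - mE) = _
    rw [smul_sub, pow_add, mul_nsmul, mul_nsmul', hmE, smul_zero, sub_zero]
  have hR'mem : p ^ (k + k₁) • R' ∈
      towerSignedLocalPointsOfEmb (towerSubgroup κ K₀) ι V 1 n := by
    rw [hR']; exact AddSubgroup.nsmul_mem _ hR _
  have hΘφ : ∀ τ : localSubgroupOfEmb (towerSubgroup κ K₀ n) ι,
      pointsMapOfEmb V ι ((Θ (φ.1 (subgroupInclusion h1
        (resGalSubgroupOfEmb (towerSubgroup κ K₀ n) ι τ))) : V.geomPrimaryTorsion p) : V.geomPoints) =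
          (τ : absoluteGaloisGroup E) • R' - R' := by
    intro τ
    have h := hφV τ
    rw [hval, AddMemClass.coe_add, AddSubgroupClass.coe_sub, Subgroup.smul_def, primaryComponent.coe_smul,
      resGalSubgroupOfEmb_apply_coe, map_add, map_sub, pointsMapOfEmb_smul] at h
    change _ + ((τ : absoluteGaloisGroup E) • mE - mE) = (τ : absoluteGaloisGroup E) • R - R at h
    change _ = (τ : absoluteGaloisGroup E) • (R - mE) - (R - mE)
    rw [eq_sub_of_add_eq h, smul_sub]
    abel
  -- `Q := Ψ⁻¹ R'` and the crossed homomorphism `ψ = ι_* ∘ φ ∘ res` on `Gal(ℚ̄_E/ℚ_n·E)`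
  let Q : localPoints W E := Ψ.symm R'
  have hΨQ : Ψ Q = R' := AddEquiv.apply_symm_apply _ _
  let ψ : B → localPoints W E := fun τ ↦
    pointsMapOfEmb W ι ((φ.1 (resGalSubgroupOfEmb (κ.layerSubgroup n) ι τ) : W.geomPrimaryTorsion p) :
      W.geomPoints)
  have hψ : ∀ σ τ : B, ψ (σ * τ) = ψ σ + (σ : absoluteGaloisGroup E) • ψ τ := by
    intro σ τ
    change pointsMapOfEmb W ι _ = pointsMapOfEmb W ι _ + _ • pointsMapOfEmb W ι _
    rw [map_mul, φ.2, AddMemClass.coe_add, map_add]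
    congr 1
    change pointsMapOfEmb W ι ((((resGalSubgroupOfEmb (κ.layerSubgroup n) ι σ) •
      φ.1 (resGalSubgroupOfEmb (κ.layerSubgroup n) ι τ) : W.geomPrimaryTorsion p)) : W.geomPoints) = _
    rw [primaryComponent.coe_smul]
    exact pointsMapOfEmb_smul W ι (σ : absoluteGaloisGroup E) _
  have hQ : ∀ a : B, a ∈ N → ψ a = (a : absoluteGaloisGroup E) • Q - Q := by
    intro a ha
    have haU : (a : absoluteGaloisGroup E) ∈ localSubgroupOfEmb (towerSubgroup κ K₀ n) ι :=
      Subgroup.mem_subgroupOf.mp ha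
    have h := hΘφ ⟨a, haU⟩
    rw [show subgroupInclusion h1 (resGalSubgroupOfEmb (towerSubgroup κ K₀ n) ι ⟨a, haU⟩) =
      resGalSubgroupOfEmb (κ.layerSubgroup n) ι a from Subtype.ext rfl] at h
    change pointsMap V E _ = _ at h
    rw [pointsMap_geomTransport] at h
    change Ψ (ψ a) = (a : absoluteGaloisGroup E) • R' - R' at h
    apply Ψ.injective
    rw [h, map_sub, ← hΨQ,
      localTransport_smul_of_smul_root_eq W K₀ hθ hc hCV E ι
        (apply_rootInClosure_of_mem K₀ (towerSubgroup_le_galRange κ K₀ n haU))]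
  -- (G1): `d • ψ` is principal with point `Q₂ = Tr Q − m₀`
  set d := Fintype.card (B ⧸ N) with hd
  have hG1 := cochain_index_nsmul_eq N ψ hψ Q hQ
  -- `Tr Q` is the `W`-side pair trace, `m₀ = ι_*(torsion)`
  have htr : (∑ q : B ⧸ N, (((q.out : B)) : absoluteGaloisGroup E) • Q) =
      localPairTraceOfEmb ι W (κ.layerSubgroup n) (towerSubgroup κ K₀ n) Q :=
    (localPairTraceOfEmb_apply ι W (κ.layerSubgroup n) (towerSubgroup κ K₀ n) Q).symm
  obtain ⟨K₀', hK₀'⟩ := AddCommGroup.mem_primaryComponent.mp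
    (∑ q : B ⧸ N, φ.1 (resGalSubgroupOfEmb (κ.layerSubgroup n) ι q.out)).2
  have hm₀ : p ^ K₀' • (∑ q : B ⧸ N, ψ q.out) = 0 := by
    change p ^ K₀' • ∑ q : B ⧸ N, pointsMapOfEmb W ι _ = 0
    rw [← map_sum, ← map_nsmul, ← AddSubmonoidClass.coe_finsetSum, hK₀', map_zero]
  -- the `p`-power multiple of `Q₂` is the η-average trace of (D4b3⁺)
  set S'' := p ^ K₀' • (p ^ (k + k₁) • R') with hS''
  have hS''mem : S'' ∈ towerSignedLocalPointsOfEmb (towerSubgroup κ K₀) ι V 1 n :=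
    AddSubgroup.nsmul_mem _ hR'mem _
  have hpKQ : p ^ (K₀' + (k + k₁)) • Q = Ψ.symm S'' := by
    rw [pow_add, mul_nsmul', hS'', map_nsmul, map_nsmul]
  have hQ₂ : p ^ (K₀' + (k + k₁)) • ((∑ q : B ⧸ N, (((q.out : B)) : absoluteGaloisGroup E) • Q) -
      ∑ q : B ⧸ N, ψ q.out) =
      localPairTraceOfEmb ι W (κ.layerSubgroup n) (towerSubgroup κ K₀ n) (Ψ.symm S'') := by
    rw [smul_sub, show p ^ (K₀' + (k + k₁)) • (∑ q : B ⧸ N, ψ q.out) = 0 by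
      rw [pow_add, mul_nsmul, hm₀, smul_zero], sub_zero, htr, ← map_nsmul, hpKQ]
  have hD4b3 := localPairTrace_localTransport_symm_mem_signed_one W K₀ hθ hc κ hCV ι η hη hD hκ₀ hS''mem
  -- the `W`-witness for `d • x`
  have hmem : d • oneCocycleClass _ φ ∈ localKummerOverOfEmb W p (κ.layerSubgroup n) ι
      (signedLocalPointsOfEmb κ ι W 1 n) := by
    refine ⟨(d : ℤ) • φ, (∑ q : B ⧸ N, (((q.out : B)) : absoluteGaloisGroup E) • Q) -
      ∑ q : B ⧸ N, ψ q.out, K₀' + (k + k₁), ?_, ?_, fun τ ↦ ?_⟩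
    · rw [← oneCocycleClassₗ_apply, map_zsmul, oneCocycleClassₗ_apply, natCast_zsmul]
    · rw [hQ₂]
      exact hD4b3
    · have hvalφ : (((d : ℤ) • φ).1 (resGalSubgroupOfEmb (κ.layerSubgroup n) ι τ) :
          W.geomPrimaryTorsion p) = d • φ.1 (resGalSubgroupOfEmb (κ.layerSubgroup n) ι τ) := by
        rw [Submodule.coe_smul, ContinuousMap.smul_apply, natCast_zsmul]
      rw [hvalφ, AddSubmonoidClass.coe_nsmul, map_nsmul]
      exact hG1 τ
  -- `x` is `p`-primary and `d` is prime to `p`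
  have hclosed : IsClosed ((κ.layerSubgroup n : Subgroup (absoluteGaloisGroup ℚ)) :
      Set (absoluteGaloisGroup ℚ)) :=
    Subgroup.isClosed_of_isOpen _ (κ.isOpen_layerSubgroup n)
  obtain ⟨j, hj⟩ := exists_pow_nsmul_eq_zero_subgroupH1_of_isClosed W p hclosed (oneCocycleClass _ φ)
  exact mem_of_coprime_nsmul_mem p _ hj
    (Nat.Coprime.coprime_dvd_left (card_layerQuotient_dvd_index_galRange K₀ p κ E ι n) hcop) hmem

include hθ hη in
/-- **(D4c⁺) THE PLUS KUMMER DICTIONARY at `p`** (both directions): for `K₀ = ℚ(μ_p)`-type data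
(`κ(Gal(ℚ̄/K₀)) = ℤ_p`, `p ∤ [Γ_ℚ : Gal(ℚ̄/K₀)]`), a class `x ∈ H¹(Gal(ℚ̄/ℚ_n), W[p^∞])` satisfies the
PLUS Kummer condition (`E⁺_W(ℚ_n·E)`, Def. 1.1, no clause) at the chosen embedding iff `Θ_n x`
satisfies cc-typer-6's verbatim PLUS Kummer condition `E⁺_V(K_{n,v}) ⊗ ℚ_p/ℤ_p`.
[cite: Kobayashi2003, §2 p. 4, Def. 1.1 (p. 2)] -/
theorem mem_localKummerOverOfEmb_signed_one_iff [(galRange (K := ℚ) K₀).Normal]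
    (hD : ∀ g : absoluteGaloisGroup ℚ, ∃ τ : absoluteGaloisGroup E,
      (resGalOfEmb (closureEmb (K := ℚ) E) τ)⁻¹ * g ∈ towerTopSubgroup κ K₀)
    (hκ₀ : ∀ x, ∃ g ∈ galRange (K := ℚ) K₀, κ g = x)
    (hcop : (galRange (K := ℚ) K₀).index.Coprime p) (n : ℕ)
    (x : W.subgroupH1 p (κ.layerSubgroup n)) :
    x ∈ localKummerOverOfEmb W p (κ.layerSubgroup n) (closureEmb (K := ℚ) E)
        (signedLocalPointsOfEmb κ (closureEmb (K := ℚ) E) W 1 n) ↔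
      h1TransportLayer W K₀ hθ hc p κ hCV n x ∈
        localKummerOverOfEmb V p (towerSubgroup κ K₀ n) (closureEmb (K := ℚ) E)
          (towerSignedLocalPointsOfEmb (towerSubgroup κ K₀) (closureEmb (K := ℚ) E) V 1 n) :=
  ⟨h1TransportLayer_mem_localKummer_towerSigned_one W K₀ hθ hc p κ hCV E hD hκ₀ n,
    mem_localKummer_signed_one_of_h1TransportLayer_mem W K₀ hθ hc p κ hCV E η hη hD hκ₀ hcop n⟩

end KummerBackward

end Summit.BirchSwinnertonDyer.Rank1Residual.Additive.SignedTwist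

end
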